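import Summits.SmoothPoincare4.SmoothPoincare4.Theses.InformationMetricHadamard
import Summits.SmoothPoincare4.SmoothPoincare4.Theorems.PICReduction
import Summits.SmoothPoincare4.SmoothPoincare4.Theorems.InformationMetricHadamardAhHadamardFillingStubLocallyConvexEndForcesHadamard

/-!
# Reduction of crux `InformationMetricHadamard.AhHadamardFilling` to its open stub X (line `Sketch`)

(item stmt-SmoothPoincare4-6014, route `InformationMetricHadamard`; lead continuation c1, 2026-08-16.)

The line `Sketch` (idea card `convex-slice-lifts-to-cover`) has landed every geometric stub and its
recognition engine K1 (`stub_locallyConvexEndForcesHadamard`,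
`Theorems/InformationMetricHadamardAhHadamardFillingStubLocallyConvexEndForcesHadamard.lean`). What
remains is the single open stub **X (`TameFillingNoPi1`)**: every homotopy 4-sphere carries a metric
`g` and is the cross-section of a proper smooth injective immersive end collar of a complete
CONNECTED Riemannian 5-manifold with `sec ≤ 0`, one far complement of which has nonempty interior
and is `δ`-locally `d`-convex, with `C⁰` cone asymptotics. This file records, as tree theorems with
X as an explicit hypothesis (pure logic over K1):

* `ahHadamardFilling_of_tameFillingNoPi1` — **X ⇒ the crux** (K1 upgrades `ConnectedSpace W` to
  `SimplyConnectedSpace W`; the other clauses pass through);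
* `smoothPoincare4_of_tameFillingNoPi1` — **X ⇒ `SmoothPoincare4`** (K1's second conclusion
  `S ≅ S⁴` for every homotopy 4-sphere, packaged by
  `Literature.SPC4.smoothPoincare4_of_forall_homotopySphere`): the open stub is SUMMIT-STRENGTH.

Together with `Theorems/AhHadamardFilling/Negative/OfSmoothPoincare4.lean`
(`SmoothPoincare4 → AhHadamardFilling`, hyperbolic witness) the crux is pinned:
`X ⇒ SmoothPoincare4 ⇒ AhHadamardFilling`.
-/

noncomputable section

-- the prescribed namespace `Summit.<P>.<Sub>.…` duplicates `SmoothPoincare4` (P = Sub)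
set_option linter.dupNamespace false

open scoped Manifold ContDiff Topology ENNReal NNReal
open Set Function

namespace Summit.SmoothPoincare4.SmoothPoincare4.Cruxes.AhHadamardFilling.Sketch

open Literature.Topology.FourManifolds (HomotopySphere)
open Literature.Geometry.Lorentzian (PseudoRiemannianMetric)

/-- **X ⇒ the crux.** If every homotopy 4-sphere admits the tame filling without `π₁` (stub X of
line `Sketch`), then `AhHadamardFilling` holds: K1 (`stub_locallyConvexEndForcesHadamard`, landed)
makes the connected filling simply connected. [folklore] -/
theorem ahHadamardFilling_of_tameFillingNoPi1
    (hX : ∀ S : HomotopySphere 4,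
      ∃ (g : PseudoRiemannianMetric (𝓡 4) ∞ (EuclideanSpace ℝ (Fin 4)) (TangentSpace (𝓡 4) : S.carrier → Type _))
      (_ : g.IsRiemannian) (W : Type) (_ : TopologicalSpace W) (_ : T2Space W)
      (_ : SecondCountableTopology W) (_ : ChartedSpace (EuclideanSpace ℝ (Fin 5)) W) (_ : IsManifold (𝓡 5) ∞ W)
      (_ : ConnectedSpace W)
      (G : PseudoRiemannianMetric (𝓡 5) ∞ (EuclideanSpace ℝ (Fin 5)) (TangentSpace (𝓡 5) : W → Type _))
      (hG : G.IsRiemannian) (c : ℝ) (Φ : S.carrier × ℝ → W),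
      0 < c ∧
      (∀ (x : W) (r : NNReal), IsCompact {y : W | G.edist hG x y ≤ r}) ∧
      (∀ cov, G.IsLeviCivita cov →
        ∀ (x : W) (X Y : TangentSpace (𝓡 5) x), G.sectionalCurvature cov x X Y ≤ 0) ∧
      ContMDiffOn ((𝓡 4).prod 𝓘(ℝ, ℝ)) (𝓡 5) ∞ Φ (univ ×ˢ Ioo (0 : ℝ) 1) ∧
      InjOn Φ (univ ×ˢ Ioo (0 : ℝ) 1) ∧
      (∀ p ∈ univ ×ˢ Ioo (0 : ℝ) 1,
        Function.Injective (mfderiv ((𝓡 4).prod 𝓘(ℝ, ℝ)) (𝓡 5) Φ p)) ∧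
      (∀ t ∈ Ioo (0 : ℝ) 1, IsCompact (Φ '' (univ ×ˢ Ioo (0 : ℝ) t))ᶜ) ∧
      (∀ t ∈ Ioo (0 : ℝ) 1,
        closure (Φ '' (univ ×ˢ Ioo (0 : ℝ) t)) ⊆ Φ '' (univ ×ˢ Ioo (0 : ℝ) 1)) ∧
      (∃ t ∈ Ioo (0 : ℝ) 1, ∃ δ : ℝ, 0 < δ ∧
        (interior (Φ '' (univ ×ˢ Ioo (0 : ℝ) t))ᶜ).Nonempty ∧
        ∀ p ∈ (Φ '' (univ ×ˢ Ioo (0 : ℝ) t))ᶜ, ∀ q ∈ (Φ '' (univ ×ˢ Ioo (0 : ℝ) t))ᶜ,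
          G.edist hG p q < ENNReal.ofReal δ →
          ∀ m : W, G.edist hG p m + G.edist hG m q = G.edist hG p q →
            m ∈ (Φ '' (univ ×ˢ Ioo (0 : ℝ) t))ᶜ) ∧
      (∀ ε : ℝ, 0 < ε → ∃ t ∈ Ioo (0 : ℝ) 1, ∀ (x : S.carrier) (l : ℝ), l ∈ Ioo (0 : ℝ) t →
        ∀ (v : TangentSpace (𝓡 4) x) (s : ℝ),
          |G.val (Φ (x, l)) (mfderiv ((𝓡 4).prod 𝓘(ℝ, ℝ)) (𝓡 5) Φ (x, l) (v, s))
              (mfderiv ((𝓡 4).prod 𝓘(ℝ, ℝ)) (𝓡 5) Φ (x, l) (v, s)) -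
            c * (s ^ 2 + g.val x v v) / l ^ 2| ≤ ε * (c * (s ^ 2 + g.val x v v) / l ^ 2))) :
    Summit.SmoothPoincare4.SmoothPoincare4.Theses.InformationMetricHadamard.AhHadamardFilling := by
  intro S
  obtain ⟨g, hg, W, i1, i2, i3, i4, i5, i6, G, hG, c, Φ, hc, hcpt, hsec, hsm, hinj, himm, hco, hcl,
    hconv, hasym⟩ := hX S
  have hK := stub_locallyConvexEndForcesHadamard S W G hG Φ hcpt hsec hsm hinj himm hco hcl hconv
  haveI : SimplyConnectedSpace W := hK.1
  exact ⟨g, hg, W, i1, i2, i3, i4, i5, inferInstance, G, hG, c, Φ, hc, hcpt, hsec, hsm, hinj, hco,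
    hcl, hasym⟩

/-- **X ⇒ `SmoothPoincare4`: the open stub of line `Sketch` is summit-strength.** K1's second
conclusion `S ≅ S⁴`, fed with X's data for every homotopy 4-sphere `S`, is the hypothesis of
`Literature.SPC4.smoothPoincare4_of_forall_homotopySphere` (with the proved packaging facts
`compactSpace_of_homotopyEquiv_sphere_four_holds` / `isOrientable_of_homotopyEquiv_sphere_four_holds`).
[folklore] -/
theorem smoothPoincare4_of_tameFillingNoPi1
    (hX : ∀ S : HomotopySphere 4,
      ∃ (g : PseudoRiemannianMetric (𝓡 4) ∞ (EuclideanSpace ℝ (Fin 4)) (TangentSpace (𝓡 4) : S.carrier → Type _))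
      (_ : g.IsRiemannian) (W : Type) (_ : TopologicalSpace W) (_ : T2Space W)
      (_ : SecondCountableTopology W) (_ : ChartedSpace (EuclideanSpace ℝ (Fin 5)) W) (_ : IsManifold (𝓡 5) ∞ W)
      (_ : ConnectedSpace W)
      (G : PseudoRiemannianMetric (𝓡 5) ∞ (EuclideanSpace ℝ (Fin 5)) (TangentSpace (𝓡 5) : W → Type _))
      (hG : G.IsRiemannian) (c : ℝ) (Φ : S.carrier × ℝ → W),
      0 < c ∧
      (∀ (x : W) (r : NNReal), IsCompact {y : W | G.edist hG x y ≤ r}) ∧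
      (∀ cov, G.IsLeviCivita cov →
        ∀ (x : W) (X Y : TangentSpace (𝓡 5) x), G.sectionalCurvature cov x X Y ≤ 0) ∧
      ContMDiffOn ((𝓡 4).prod 𝓘(ℝ, ℝ)) (𝓡 5) ∞ Φ (univ ×ˢ Ioo (0 : ℝ) 1) ∧
      InjOn Φ (univ ×ˢ Ioo (0 : ℝ) 1) ∧
      (∀ p ∈ univ ×ˢ Ioo (0 : ℝ) 1,
        Function.Injective (mfderiv ((𝓡 4).prod 𝓘(ℝ, ℝ)) (𝓡 5) Φ p)) ∧
      (∀ t ∈ Ioo (0 : ℝ) 1, IsCompact (Φ '' (univ ×ˢ Ioo (0 : ℝ) t))ᶜ) ∧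
      (∀ t ∈ Ioo (0 : ℝ) 1,
        closure (Φ '' (univ ×ˢ Ioo (0 : ℝ) t)) ⊆ Φ '' (univ ×ˢ Ioo (0 : ℝ) 1)) ∧
      (∃ t ∈ Ioo (0 : ℝ) 1, ∃ δ : ℝ, 0 < δ ∧
        (interior (Φ '' (univ ×ˢ Ioo (0 : ℝ) t))ᶜ).Nonempty ∧
        ∀ p ∈ (Φ '' (univ ×ˢ Ioo (0 : ℝ) t))ᶜ, ∀ q ∈ (Φ '' (univ ×ˢ Ioo (0 : ℝ) t))ᶜ,
          G.edist hG p q < ENNReal.ofReal δ →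
          ∀ m : W, G.edist hG p m + G.edist hG m q = G.edist hG p q →
            m ∈ (Φ '' (univ ×ˢ Ioo (0 : ℝ) t))ᶜ) ∧
      (∀ ε : ℝ, 0 < ε → ∃ t ∈ Ioo (0 : ℝ) 1, ∀ (x : S.carrier) (l : ℝ), l ∈ Ioo (0 : ℝ) t →
        ∀ (v : TangentSpace (𝓡 4) x) (s : ℝ),
          |G.val (Φ (x, l)) (mfderiv ((𝓡 4).prod 𝓘(ℝ, ℝ)) (𝓡 5) Φ (x, l) (v, s))
              (mfderiv ((𝓡 4).prod 𝓘(ℝ, ℝ)) (𝓡 5) Φ (x, l) (v, s)) -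
            c * (s ^ 2 + g.val x v v) / l ^ 2| ≤ ε * (c * (s ^ 2 + g.val x v v) / l ^ 2))) :
    _root_.SmoothPoincare4 := by
  refine Literature.SPC4.smoothPoincare4_of_forall_homotopySphere
    Literature.Topology.FourManifolds.compactSpace_of_homotopyEquiv_sphere_four_holds
    Literature.Topology.FourManifolds.isOrientable_of_homotopyEquiv_sphere_four_holds ?_
  intro S
  obtain ⟨g, hg, W, i1, i2, i3, i4, i5, i6, G, hG, c, Φ, hc, hcpt, hsec, hsm, hinj, himm, hco, hcl,
    hconv, hasym⟩ := hX S
  exact (stub_locallyConvexEndForcesHadamard S W G hG Φ hcpt hsec hsm hinj himm hco hcl hconv).2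

end Summit.SmoothPoincare4.SmoothPoincare4.Cruxes.AhHadamardFilling.Sketch

end
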